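import Literature.NumberTheory.EllipticCurves.ShaIsogeny
import Literature.NumberTheory.EllipticCurves.IsogenyBaseChange
import HarnessLib

/-!
# Isogenies act on local points: proof of `WeierstrassCurve.Isogeny.hasLocalPointsMaps`

Topic `NumberTheory/EllipticCurves`. `ShaIsogeny.lean` proves Milne's Lemma I.7.1(b)
(finiteness of `Ш` is an isogeny invariant, for elliptic curves over number fields) from one
geometric input, isolated there as the named fact `WeierstrassCurve.Isogeny.hasLocalPointsMaps`:
an isogeny `φ : E → E'` defined over `K` — recorded in the tree by its `Γ_K`-equivariant action on
`K̄`-points (`WeierstrassCurve.Isogeny`) — acts, for every field `E ⊇ K`, on the local points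
`E(K̄_E) → E'(K̄_E)` by a `Γ_E`-equivariant homomorphism compatible with the chosen
`K`-embedding `K̄ → K̄_E` (`Literature.NumberTheory.EllipticCurves.HasLocalPointsMaps`).
This file **proves** that fact (`WeierstrassCurve.Isogeny.hasLocalPointsMaps_holds`): the
required map is the base change `φ_{K̄_E}` of `IsogenyBaseChange.lean`
(`WeierstrassCurve.Isogeny.baseChange`, additive by the specialization argument of
`PointSpecialization.lean`) for the `K̄`-algebra structure on `K̄_E` given by
`Literature.NumberTheory.EllipticCurves.closureEmb E`; compatibility with `K̄ → K̄_E` is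
`Isogeny.baseChange_map`, and `Γ_E`-equivariance is the semilinear functoriality
`Isogeny.map_baseChange` applied to `τ ∈ Γ_E` and its restriction
`τ|_{K̄} = resGal E τ ∈ Γ_K` (`Literature.NumberTheory.EllipticCurves.apply_resGalAuxOfEmb_apply`).
As corollaries, the isogeny invariance of the finiteness of `Ш` becomes unconditional
(`Isogeny.shaFinite_iff_shaFinite`, `IsIsogenous.shaFinite_iff_shaFinite`).

## Main statements

* `WeierstrassCurve.Isogeny.localPointsMap φ E : localPoints W E →+ localPoints W' E`;
  `localPointsMap_pointsMap` (`φ_E ∘ ι_* = ι_* ∘ φ`), `localPointsMap_smul` (`Γ_E`-equivariance);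
  `Isogeny.hasLocalPointsMaps_toAddMonoidHom` (`HasLocalPointsMaps` for every isogeny).
* **`WeierstrassCurve.Isogeny.hasLocalPointsMaps_holds : Isogeny.hasLocalPointsMaps W W'`**.
* `WeierstrassCurve.Isogeny.shaFinite_of_shaFinite_codomain`, `Isogeny.shaFinite_iff_shaFinite`,
  `WeierstrassCurve.IsIsogenous.shaFinite_iff_shaFinite`:
  for (`K`-isogenous) elliptic curves over a number field, `Ш(E/K)` is finite iff `Ш(E'/K)` is —
  Milne, *ADT*, Lemma I.7.1(b) (Cassels 1965), now free of hypotheses.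

## References

* J. H. Silverman, *The Arithmetic of Elliptic Curves*, 2nd ed., GTM 106 (2009), I.§3 (rational
  maps, `φ^σ`, "defined over `K`"), II.2.1, III.§4 (isogenies; Thm. III.4.8). [SilvermanAEC2009]
* J. S. Milne, *Arithmetic Duality Theorems*, 2nd ed. (2006), Ch. I, Lemma 7.1(b), p. 96.
  [MilneADT2006]
* J.-P. Serre, *Galois Cohomology* (1997), II.§1.1 (compatibility of `Γ_E → Γ_K` with the
  embeddings of algebraic closures). [SerreGaloisCohomology1997]

## Design notes

* The `K̄`-algebra structure on `K̄_E = AlgebraicClosure E` is the local instance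
  `(closureEmb E).toRingHom.toAlgebra` (with its `IsScalarTower K K̄ K̄_E`), introduced by
  `letI` inside `localPointsMap` and the two lemmas about it, exactly as in
  `Literature.NumberTheory.EllipticCurves.resGalAuxOfEmb` (`Sha.lean`); for it,
  `IsScalarTower.toAlgHom K K̄ K̄_E = closureEmb E` definitionally.
* The hypothesis `[PerfectField K]` of the named fact is not needed by the proof (equivariance
  is transported along `resGal` for any `K`); it is simply introduced and ignored.
-/

noncomputable section

open scoped Classical

universe u

namespace WeierstrassCurve

namespace Isogeny

open Literature.NumberTheory.EllipticCurves
open Field (absoluteGaloisGroup)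

variable {K : Type u} [Field K] {W W' : WeierstrassCurve K}

section LocalPointsMap

variable (φ : Isogeny W W') (E : Type u) [Field E] [Algebra K E]

/-- **The local points map of an isogeny** at a `K`-field `E`: the base change
`φ_{K̄_E} : E(K̄_E) →+ E'(K̄_E)` of `φ` (`Isogeny.baseChange`, file `IsogenyBaseChange`) along
the chosen `K`-embedding `closureEmb E : K̄ → K̄_E`, which makes `K̄_E` a `K̄`-algebra. This is
the map `f_E` required by `Literature.NumberTheory.EllipticCurves.HasLocalPointsMaps`.
Silverman, *AEC*, I.§3, III.§4. [folklore] -/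
def localPointsMap : localPoints W E →+ localPoints W' E :=
  letI : Algebra (AlgebraicClosure K) (AlgebraicClosure E) :=
    (closureEmb (K := K) E).toRingHom.toAlgebra
  haveI : IsScalarTower K (AlgebraicClosure K) (AlgebraicClosure E) :=
    IsScalarTower.of_algebraMap_eq fun x ↦ ((closureEmb (K := K) E).commutes x).symm
  φ.baseChange (M := AlgebraicClosure E)

/-- **Compatibility with `K̄ → K̄_E`**: `φ_E (ι_* P) = ι_* (φ P)` for the chosen embedding
`ι = closureEmb E` (`Isogeny.baseChange_map`). [folklore] -/
theorem localPointsMap_pointsMap (P : W.geomPoints) :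
    φ.localPointsMap E (pointsMap W E P) = pointsMap W' E (φ P) := by
  letI : Algebra (AlgebraicClosure K) (AlgebraicClosure E) :=
    (closureEmb (K := K) E).toRingHom.toAlgebra
  haveI : IsScalarTower K (AlgebraicClosure K) (AlgebraicClosure E) :=
    IsScalarTower.of_algebraMap_eq fun x ↦ ((closureEmb (K := K) E).commutes x).symm
  have hι : IsScalarTower.toAlgHom K (AlgebraicClosure K) (AlgebraicClosure E) =
      closureEmb (K := K) E :=
    AlgHom.ext fun _ ↦ rfl
  change φ.baseChange (Affine.Point.map (closureEmb (K := K) E) P) =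
    Affine.Point.map (closureEmb (K := K) E) (φ P)
  rw [← hι]
  exact φ.baseChange_map P

/-- **`Γ_E`-equivariance**: `φ_E (τ • P) = τ • φ_E P` for `τ ∈ Γ_E = Gal(K̄_E/E)` — the semilinear
functoriality of the base change (`Isogeny.map_baseChange`) for `f = τ` (a `K`-algebra
automorphism of `K̄_E`) and `σ = τ|_{K̄} = resGal E τ ∈ Γ_K`
(`Literature.NumberTheory.EllipticCurves.apply_resGalAuxOfEmb_apply`: `ι (σ c) = τ (ι c)`).
Serre, *Galois Cohomology*, II.§1.1; Silverman, *AEC*, I.§3. [folklore] -/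
theorem localPointsMap_smul (τ : absoluteGaloisGroup E) (P : localPoints W E) :
    φ.localPointsMap E (τ • P) = τ • φ.localPointsMap E P := by
  letI : Algebra (AlgebraicClosure K) (AlgebraicClosure E) :=
    (closureEmb (K := K) E).toRingHom.toAlgebra
  haveI : IsScalarTower K (AlgebraicClosure K) (AlgebraicClosure E) :=
    IsScalarTower.of_algebraMap_eq fun x ↦ ((closureEmb (K := K) E).commutes x).symm
  symm
  exact φ.map_baseChange
    (AlgEquiv.restrictScalars K (show AlgebraicClosure E ≃ₐ[E] AlgebraicClosure E from τ) :
      AlgebraicClosure E →ₐ[K] AlgebraicClosure E)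
    (resGal (K := K) E τ)
    (fun c ↦ (apply_resGalAuxOfEmb_apply (closureEmb (K := K) E) τ c).symm) P

end LocalPointsMap

/-- **Every isogeny has local points maps** (`Literature.NumberTheory.EllipticCurves.HasLocalPointsMaps`
for `φ.toAddMonoidHom`), witnessed by `localPointsMap`. [folklore] -/
theorem hasLocalPointsMaps_toAddMonoidHom (φ : Isogeny W W') :
    HasLocalPointsMaps W W' φ.toAddMonoidHom :=
  fun E _ _ ↦ ⟨φ.localPointsMap E, φ.localPointsMap_smul E, φ.localPointsMap_pointsMap E⟩

/-- **Isogenies act on the points over every extension field** — the named fact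
`WeierstrassCurve.Isogeny.hasLocalPointsMaps` of `ShaIsogeny.lean`, **proved**: for an isogeny
`φ : E → E'` over `K` (recorded by its `Γ_K`-equivariant action on `K̄`-points) and every field
`E ⊇ K` there is a `Γ_E`-equivariant homomorphism `φ_E : E(K̄_E) → E'(K̄_E)` with
`φ_E ∘ ι_* = ι_* ∘ φ` for the chosen `K`-embedding `ι : K̄ → K̄_E` — namely the base change of
`φ` (`Isogeny.localPointsMap`, `Isogeny.baseChange`), additive by the specialization principle
(`PointSpecialization`, `IsogenyBaseChange`). The perfectness hypothesis of the fact is not used.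
Silverman, *AEC*, I.§3, II.2.1, III.§4 (Thm. III.4.8). [folklore] -/
theorem hasLocalPointsMaps_holds (W W' : WeierstrassCurve K) :
    Isogeny.hasLocalPointsMaps W W' :=
  fun φ ↦ φ.hasLocalPointsMaps_toAddMonoidHom

/-- **`Ш(E'/K)` finite ⇒ `Ш(E/K)` finite along any isogeny `φ : E → E'`** of elliptic curves over
a number field, unconditionally (`Isogeny.shaFinite_of_shaFinite` with
`hasLocalPointsMaps_toAddMonoidHom`). Milne, *ADT*, Lemma I.7.1(b).
[cite: MilneADT2006, Ch. I Lemma 7.1(b), p. 96] -/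
theorem shaFinite_of_shaFinite_codomain [NumberField K] [W.IsElliptic] [W'.IsElliptic]
    (φ : Isogeny W W') (h : W'.ShaFinite) : W.ShaFinite :=
  φ.shaFinite_of_shaFinite φ.hasLocalPointsMaps_toAddMonoidHom h

/-- **Milne, *ADT*, Lemma I.7.1(b), for an isogeny of elliptic curves over a number field,
unconditionally**: `Ш(E/K)` is finite iff `Ш(E'/K)` is (`Isogeny.shaFinite_iff` with the fact
`Isogeny.hasLocalPointsMaps` discharged in both directions).
[cite: MilneADT2006, Ch. I Lemma 7.1(b), p. 96] -/
theorem shaFinite_iff_shaFinite [NumberField K] [W.IsElliptic] [W'.IsElliptic]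
    (φ : Isogeny W W') : W.ShaFinite ↔ W'.ShaFinite :=
  φ.shaFinite_iff (hasLocalPointsMaps_holds W W') (hasLocalPointsMaps_holds W' W)

end Isogeny

/-- **Finiteness of `Ш` is an isogeny invariant** (Milne, *ADT*, Lemma I.7.1(b); Cassels 1965 for
elliptic curves), unconditionally: for `K`-isogenous elliptic curves `E, E'` over a number field
`K`, `Ш(E/K)` is finite iff `Ш(E'/K)` is (`IsIsogenous.shaFinite_iff` with
`Isogeny.hasLocalPointsMaps_holds`). [cite: MilneADT2006, Ch. I Lemma 7.1(b), p. 96] -/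
theorem IsIsogenous.shaFinite_iff_shaFinite {K : Type u} [Field K] [NumberField K]
    {W W' : WeierstrassCurve K} [W.IsElliptic] [W'.IsElliptic] (hiso : IsIsogenous W W') :
    W.ShaFinite ↔ W'.ShaFinite :=
  hiso.shaFinite_iff (Isogeny.hasLocalPointsMaps_holds W W')
    (Isogeny.hasLocalPointsMaps_holds W' W)

end WeierstrassCurve
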